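import Summits.MatrixMultiplication.OmegaCensus.STPPVosperSlackFourCell22Checker
import Summits.MatrixMultiplication.OmegaCensus.STPPVosperSlackFourCell22Shapes
import Summits.MatrixMultiplication.OmegaCensus.STPPVosperSlackFourCell22TableP2
import Summits.MatrixMultiplication.OmegaCensus.STPPVosperSlackTwoLawABQ

/-!
# ω-census (abelian STPP census): cell (2,2) of the slack-4 law (fifth ℤ₆₁ leaf) — checker rows, file 15 of 42 (u = 21; kernel computations)

HONEST FRAMING (pub-omega census; verbatim): lottery ticket; floor = certified bounds/negative ranges.
Census STRUCTURE (seat pub-omega-stpp-2 gen 28, 2026-08-29), family (b2).  Rows `c22CheckS 61 u (c22P 61 y₀) (c22Q 61 u y₀′) S (c22TShapes 61 u (c22Sh y₀′)) tbl22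
= true` (`STPPVosperSlackFourCell22Checker.lean`) over chunks of the shape list `c22Sh y₀`, sized by the python twin's operation counts
(HOME `pub-omega-stpp-2-g28/code/c22_rows_data.json`, ≈ 0.25 ms per twin step on the farm); each theorem is ONE `decide +kernel`; block theorems
`c22b_u_y₀_y₀′` glue the chunks of a block.  Nothing here is progress on `ω`.
-/

namespace Summit.MatrixMultiplication.OmegaCensus.CubeNB.S2

open Summit.MatrixMultiplication.OmegaCensus.CubeNB

/-- Cell-(2,2) rows, block `(21, 2, 2)`, shapes `[0, 126)` (≈ 294824 twin steps). [folklore] -/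
theorem c22c_21_2_2_0 : ∀ S ∈ ((c22Sh 2).drop 0).take 126, c22CheckS 61 21 (c22P 61 2) (c22Q 61 21 2) S (c22TShapes 61 21 (c22Sh 2)) tbl22 = true :=
  List.all_eq_true.1 (by decide +kernel : ((((c22Sh 2).drop 0).take 126).all fun S => c22CheckS 61 21 (c22P 61 2) (c22Q 61 21 2) S (c22TShapes 61 21 (c22Sh 2)) tbl22) = true)

/-- Cell-(2,2) rows, block `(21, 2, 2)`, shapes `[126, 155)` (≈ 297394 twin steps). [folklore] -/
theorem c22c_21_2_2_1 : ∀ S ∈ ((c22Sh 2).drop 126).take 29, c22CheckS 61 21 (c22P 61 2) (c22Q 61 21 2) S (c22TShapes 61 21 (c22Sh 2)) tbl22 = true :=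
  List.all_eq_true.1 (by decide +kernel : ((((c22Sh 2).drop 126).take 29).all fun S => c22CheckS 61 21 (c22P 61 2) (c22Q 61 21 2) S (c22TShapes 61 21 (c22Sh 2)) tbl22) = true)

end Summit.MatrixMultiplication.OmegaCensus.CubeNB.S2
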